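import Literature.Topology.FourManifolds.TautFoliationsCollarRingLeaf
import HarnessLib

/-!
# The leaves of the contour foliation through the wiggly ring are compact

Topic: the coned fence collar (C4c, second half). With the notation of
`TautFoliationsCollarRingLeaf.lean`: (1) near every point of the wiggly ring `W_R` in the carrier,
the points of `W_R` lie on one plaque of a chart at the point (`exists_nhds_samePlaque`: inside an
open square the plane charts read the cone height, which is the radial level on `W_R`; at a
point of an open edge the edge chart reads the canonical glued height, equal on both sides to
the level of the roof square by the compatibility `ψ₁ = σ ∘ ψ₂` at the point, a ring point);
(2) for a generic radius (no vertex at distance `R`, and `R + 2ℓ < L`) the wiggly ring lies in the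
carrier (`wigglyRing_subset_X₀`); (3) hence the leaf through a point of `W_R`, which stays in `W_R`
(`leaf_subset_wigglyRing`), is closed in the plane and **compact** (`isCompact_leaf_of_mem_wigglyRing`).
These are the essential compact leaves of the coned collar (their images are computed in the
sequel).

* `H_eq_of_mem_ball`, `dist_eq_of_not_mem_ball`, `exists_nhds_samePlaque`, `wigglyRing_subset_X₀`,
  `isCompact_leaf_of_mem_wigglyRing` (**proved**).

All statements are [folklore].
-/

noncomputable section

open Set Filter Metric Topology Function Real
open scoped unitInterval
open Literature.Topology.PlanarFoliations

namespace Literature.Topology.FourManifolds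

namespace Foliation.ConePosition

open SquareGrid SquareGrid.Grid SquarePolar ConeSquare CollarRadius

variable {B : Type*} [NormedAddCommGroup B] [NormedSpace ℝ B] {M : Type*} [TopologicalSpace M] {F : Foliation B M}
variable {Γ : C(I, F.GermSpace)} {τ₀ ε : ℝ} {Φ : I → ℝ → M} {c₀ : ℝ × ℝ} {L : ℝ} {hL : 0 < L} {G : ℝ × ℝ → M}
variable (P : ConePosition F G c₀ hL)

variable (hΦ : IsFenceOn F Γ τ₀ ε Φ univ) (hcl : ∀ τ ∈ Ioo (τ₀ - ε) (τ₀ + ε), Φ 1 τ = Φ 0 τ) {τ₁ : ℝ}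
  (hτI : uIcc τ₀ τ₁ ⊆ Ioo (τ₀ - ε) (τ₀ + ε)) (h01 : τ₁ ≠ τ₀)
  (hG : ∀ x, L / 2 ≤ dist x c₀ → G x = Φ (angleParam c₀ x) (levelOfParam τ₀ τ₁ (1 - dist x c₀ / L)))
  (hGc : Continuous G) (hn32 : 32 ≤ P.n)
  (hskelT : ∀ q k, P.gr.edge q k '' Icc 0 (2 * P.gr.ℓ) ⊆ {x | 7 * L / 8 ≤ dist x c₀} →
    ∀ s ∈ Icc 0 (2 * P.gr.ℓ), P.skel (P.gr.edge q k s) = G (P.gr.edge q k s))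
  {R : ℝ} (hR : 15 * L / 16 ≤ R)

omit [NormedSpace ℝ B] in
/-- A point of a closed square in the open square of another forces equality of the squares. [folklore] -/
theorem eq_of_mem_sq_of_mem_ball {q q₁ : Fin P.n × Fin P.n} {y : ℝ × ℝ} (hy : y ∈ P.gr.sq q) (hyb : y ∈ ball (P.gr.centre q₁) P.gr.ℓ) :
    q = q₁ := by
  by_contra hne
  exact disjoint_left.1 (P.gr.ball_disjoint_sq (Ne.symm hne)) hyb hy

/-- **In an open square, a point of the wiggly ring is at the radial level of that square**, and
the square meets the ring. [folklore] -/
theorem H_eq_of_mem_ball (ho : F.IsTransverselyOriented) {q : Fin P.n × Fin P.n} {y : ℝ × ℝ} (hy : y ∈ P.wigglyRing R)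
    (hyb : y ∈ ball (P.gr.centre q) P.gr.ℓ) : (P.datum ho).H q y = P.radialHt q R ∧ (P.gr.sq q ∩ sphere c₀ R).Nonempty := by
  obtain ⟨q', hq'R, hy'⟩ := mem_iUnion₂.1 hy
  have hq : q' = q := P.eq_of_mem_sq_of_mem_ball hy'.1 hyb
  subst hq
  exact ⟨hy'.2, hq'R⟩

include hΦ hcl hτI h01 hG hGc hn32 hskelT hR in
omit [NormedSpace ℝ B] in
/-- **Off the open squares a point of the wiggly ring is a ring point.** [folklore] -/
theorem dist_eq_of_not_mem_ball {y : ℝ × ℝ} (hy : y ∈ P.wigglyRing R) (hnot : ∀ q, y ∉ ball (P.gr.centre q) P.gr.ℓ) :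
    dist y c₀ = R := by
  obtain ⟨q', hq'R, hy'⟩ := mem_iUnion₂.1 hy
  have hys : y ∈ sphere (P.gr.centre q') P.gr.ℓ := by
    rcases (mem_closedBall.1 hy'.1).lt_or_eq with hlt | heq
    · exact absurd (mem_ball.2 hlt) (hnot q')
    · exact mem_sphere.2 heq
  exact P.dist_eq_of_mem_ringLevel_of_mem_sphere hΦ hcl hτI h01 hG hGc hn32 hskelT hR hq'R hy' hys

include hΦ hcl hτI h01 hG hGc hn32 hskelT hR in
/-- **Local plaques through the wiggly ring**: near a point of the wiggly ring in the carrier, the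
points of the wiggly ring lie on one plaque of a chart at the point. [folklore] -/
theorem exists_nhds_samePlaque (ho : F.IsTransverselyOriented) (v : P.gr.X₀) (hv : (v : ℝ × ℝ) ∈ P.wigglyRing R) :
    ∃ V : Set P.gr.X₀, IsOpen V ∧ v ∈ V ∧ ∀ w ∈ V, (w : ℝ × ℝ) ∈ P.wigglyRing R → (P.datum ho).foliation.SamePlaque v w := by
  classical
  haveI := P.gr.nonempty_X₀
  have hℓ := P.gr.hℓ
  -- a chart of the datum at `v`
  obtain ⟨c, ⟨ĉ, hĉ, rfl⟩, hvs⟩ := (P.datum ho).cover v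
  have hvsrc : (v : ℝ × ℝ) ∈ ĉ.source := by rwa [OpenPartialHomeomorph.subtypeRestr_source] at hvs
  obtain ⟨r, hrr, hmem, hvr⟩ := (P.datum ho).preAtlas.exists_mem_atlas_of_mem_source (c := ĉ.subtypeRestr P.gr.nonempty_X₀)
    ⟨ĉ, hĉ, rfl⟩ hvs
  set rb := renormBox (ĉ.subtypeRestr P.gr.nonempty_X₀) ((ĉ.subtypeRestr P.gr.nonempty_X₀) v) r hrr with hrb
  have hsrcw : ∀ w ∈ rb.source, (w : ℝ × ℝ) ∈ ĉ.source := fun w hw ↦ by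
    have := renormBox_source_subset _ _ _ _ hw
    rwa [OpenPartialHomeomorph.subtypeRestr_source] at this
  -- the plaque relation in `rb` reduces to equality of `ĉ`-heights
  have hplaque : ∀ w ∈ rb.source, (ĉ v).2 = (ĉ w).2 → (P.datum ho).foliation.SamePlaque v w := fun w hw hh ↦
    ⟨rb, hmem, hvr, hw, (renormBox_snd_eq_iff hvr hw).2 hh⟩
  rcases hĉ with ⟨q₁, h₁, k, rfl⟩ | ⟨q₁, h₁, k, rfl⟩ | ⟨q₁, q₂, T, hn, hr₁, hf₂, E, rfl⟩
  · -- roof chart of `q₁`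
    refine ⟨rb.source, rb.open_source, hvr, fun w hw hwW ↦ hplaque w hw ?_⟩
    have hvb := (P.datum ho).roofChart_source_subset h₁ k hvsrc
    have hwb := (P.datum ho).roofChart_source_subset h₁ k (hsrcw w hw)
    rw [(P.datum ho).roofChart_snd h₁ k, (P.datum ho).roofChart_snd h₁ k, (P.H_eq_of_mem_ball ho hv hvb).1,
      (P.H_eq_of_mem_ball ho hwW hwb).1]
  · -- floor chart
    refine ⟨rb.source, rb.open_source, hvr, fun w hw hwW ↦ hplaque w hw ?_⟩
    have hvb := (P.datum ho).floorChart_source_subset h₁ k hvsrc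
    have hwb := (P.datum ho).floorChart_source_subset h₁ k (hsrcw w hw)
    rw [(P.datum ho).floorChart_snd h₁ k, (P.datum ho).floorChart_snd h₁ k, (P.H_eq_of_mem_ball ho hv hvb).1,
      (P.H_eq_of_mem_ball ho hwW hwb).1]
  · -- edge chart between the roof `q₁` and the floor `q₂`
    set a := P.gr.centre q₁ with ha
    set b := P.gr.centre q₂ with hb
    have hne : q₂ ≠ q₁ := fun h ↦ hf₂ (h ▸ hr₁)
    -- canonical heights on the source
    have hcanon : ∀ u ∈ E.chart.source, (E.chart u).2 = (if dist u a ≤ P.gr.ℓ then (P.datum ho).H q₁ u else (P.datum ho).σ q₁ q₂ ((P.datum ho).H q₂ u)) :=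
      fun u hu ↦ E.chart_snd_eq_canonHt hu
    have hnotle_of_ball_b : ∀ {u : ℝ × ℝ}, u ∈ ball b P.gr.ℓ → ¬ dist u a ≤ P.gr.ℓ := fun {u} hub hle ↦
      disjoint_left.1 (P.gr.ball_disjoint_sq hne) hub (mem_closedBall.2 hle)
    rcases E.source_subset hvsrc with (hvb | hvb) | hvedge
    · -- `v` in the open square of `q₁`
      have hVo : IsOpen (rb.source ∩ ((↑) : P.gr.X₀ → ℝ × ℝ) ⁻¹' ball a P.gr.ℓ) :=
        rb.open_source.inter (isOpen_ball.preimage continuous_subtype_val)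
      refine ⟨_, hVo, ⟨hvr, hvb⟩, fun w hw hwW ↦ hplaque w hw.1 ?_⟩
      rw [hcanon _ hvsrc, hcanon _ (hsrcw w hw.1), if_pos (mem_ball.1 hvb).le, if_pos (mem_ball.1 hw.2).le,
        (P.H_eq_of_mem_ball ho hv hvb).1,
        (P.H_eq_of_mem_ball ho hwW hw.2).1]
    · -- `v` in the open square of `q₂`
      have hVo : IsOpen (rb.source ∩ ((↑) : P.gr.X₀ → ℝ × ℝ) ⁻¹' ball b P.gr.ℓ) :=
        rb.open_source.inter (isOpen_ball.preimage continuous_subtype_val)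
      refine ⟨_, hVo, ⟨hvr, hvb⟩, fun w hw hwW ↦ hplaque w hw.1 ?_⟩
      rw [hcanon _ hvsrc, hcanon _ (hsrcw w hw.1), if_neg (hnotle_of_ball_b hvb), if_neg (hnotle_of_ball_b hw.2),
        (P.H_eq_of_mem_ball ho hv hvb).1,
        (P.H_eq_of_mem_ball ho hwW hw.2).1]
    · -- `v` on the open edge: a ring point; both levels agree with the canonical height
      have hvs₁ : (v : ℝ × ℝ) ∈ sphere a P.gr.ℓ := hvedge.1
      have hvs₂ : (v : ℝ × ℝ) ∈ sphere b P.gr.ℓ := hvedge.2.1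
      have hvR : dist (v : ℝ × ℝ) c₀ = R :=
        P.dist_eq_of_not_mem_ball hΦ hcl hτI h01 hG hGc hn32 hskelT hR hv fun q ↦ P.gr.not_mem_ball_of_mem_openEdge hvedge
      have hψ₁ : P.bdryHt q₁ v = P.radialHt q₁ R := P.bdryHt_eq_radialHt hΦ hcl hτI h01 hG hGc hn32 hskelT hR hvs₁ hvR
      have hψ₂ : P.bdryHt q₂ v = P.radialHt q₂ R := P.bdryHt_eq_radialHt hΦ hcl hτI h01 hG hGc hn32 hskelT hR hvs₂ hvR
      have hcompat : (P.datum ho).ψ q₁ v = (P.datum ho).σ q₁ q₂ ((P.datum ho).ψ q₂ v) := E.compat v ⟨hvs₁, hvs₂⟩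
      have hid : P.radialHt q₁ R = (P.datum ho).σ q₁ q₂ (P.radialHt q₂ R) := by
        rw [← hψ₁, ← hψ₂]; exact hcompat
      -- the `q₁`-height at a point of the source with `dist ≤ ℓ` which is on `W_R`
      have hleft : ∀ u ∈ E.chart.source, u ∈ P.wigglyRing R → dist u a ≤ P.gr.ℓ → (P.datum ho).H q₁ u = P.radialHt q₁ R := by
        intro u hu huW hule
        rcases hule.lt_or_eq with hlt | heq
        · exact (P.H_eq_of_mem_ball ho huW (mem_ball.2 hlt)).1
        · -- on the sphere of `q₁`: an open-edge point, a ring point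
          have hus₁ : u ∈ sphere a P.gr.ℓ := mem_sphere.2 heq
          have huedge : u ∈ openEdge a b P.gr.ℓ := by
            rcases E.source_subset hu with (hub | hub) | he'
            · exact absurd (mem_ball.1 hub) (by rw [heq]; exact lt_irrefl _)
            · exact absurd hub (fun hub ↦ disjoint_left.1 (P.gr.ball_disjoint_sq hne) hub (P.gr.sphere_subset_sq q₁ hus₁))
            · exact he'
          have huR : dist u c₀ = R :=
            P.dist_eq_of_not_mem_ball hΦ hcl hτI h01 hG hGc hn32 hskelT hR huW fun q ↦ P.gr.not_mem_ball_of_mem_openEdge huedge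
          show coneHt (P.gr.centre q₁) P.gr.ℓ ((P.datum ho).m q₁) ((P.datum ho).ψ q₁) u = _
          rw [coneHt_of_mem_sphere hℓ hus₁]
          exact P.bdryHt_eq_radialHt hΦ hcl hτI h01 hG hGc hn32 hskelT hR hus₁ huR
      have hval : ∀ u ∈ E.chart.source, u ∈ P.wigglyRing R → (E.chart u).2 = P.radialHt q₁ R := by
        intro u hu huW
        rw [hcanon u hu]
        by_cases hule : dist u a ≤ P.gr.ℓ
        · rw [if_pos hule, hleft u hu huW hule]
        · rw [if_neg hule, hid]
          have hub : u ∈ ball b P.gr.ℓ := by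
            rcases E.source_subset hu with (hub | hub) | he'
            · exact absurd (mem_ball.1 hub).le hule
            · exact hub
            · exact absurd (mem_sphere.1 he'.1).le hule
          rw [(P.H_eq_of_mem_ball ho huW hub).1]
      refine ⟨rb.source, rb.open_source, hvr, fun w hw hwW ↦ hplaque w hw ?_⟩
      rw [hval _ hvsrc hv, hval _ (hsrcw w hw) hwW]

include hΦ hcl hτI h01 hG hGc hn32 hskelT hR in
omit [NormedSpace ℝ B] in
/-- **For a generic radius the wiggly ring lies in the carrier**: no vertex is at distance `R`
from `c₀`, and `R + 2ℓ < L`. [folklore] -/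
theorem wigglyRing_subset_X₀ (hvert : ∀ v ∈ P.gr.vertices, dist v c₀ ≠ R) (hRL : R + 2 * P.gr.ℓ < L) :
    ∀ x ∈ P.wigglyRing R, x ∈ (P.gr.X₀ : Set (ℝ × ℝ)) := by
  intro x hx
  obtain ⟨q, hqR, hxq⟩ := mem_iUnion₂.1 hx
  obtain ⟨hc, hnl⟩ := grid_bigCentre (c₀ := c₀) hL P.hn
  rw [SetLike.mem_coe, P.gr.mem_X₀_iff, hc, hnl]
  refine ⟨?_, ?_, ?_⟩
  · -- inside the open big square
    obtain ⟨x₀, hx₀, hx₀R⟩ := hqR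
    have h1 : dist x x₀ ≤ 2 * P.gr.ℓ := by
      have := dist_triangle x (P.gr.centre q) x₀
      have h2 := mem_closedBall.1 hxq.1; have h3 := mem_closedBall.1 hx₀; rw [dist_comm] at h3; linarith
    rw [mem_ball]
    calc dist x c₀ ≤ dist x x₀ + dist x₀ c₀ := dist_triangle _ _ _
      _ < L := by rw [mem_sphere.1 hx₀R]; linarith
  · -- not a centre: the level is not the apex
    rintro ⟨q', hq'⟩
    have hq : q' = q := by
      have hb : x ∈ ball (P.gr.centre q') P.gr.ℓ := by rw [← hq']; exact mem_ball_self P.gr.hℓ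
      exact (P.eq_of_mem_sq_of_mem_ball hxq.1 hb).symm
    subst hq
    have hH : (coneHt (P.gr.centre q') P.gr.ℓ (P.apex q') (P.bdryHt q') x) = P.radialHt q' R := hxq.2
    rw [← hq', coneHt_center] at hH
    obtain ⟨hro, hfl⟩ := P.radialHt_lt_apex_or hΦ hcl hτI h01 hG hGc hn32 hskelT hR hqR
    by_cases hroof : P.roofPat q'
    · exact absurd hH (ne_of_gt (hro hroof))
    · exact absurd hH (ne_of_lt (hfl hroof))
  · -- not a vertex: a vertex of the closed square is on its boundary, hence a ring point
    intro hxv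
    have hxs : x ∈ sphere (P.gr.centre q) P.gr.ℓ := by
      rcases (mem_closedBall.1 hxq.1).lt_or_eq with hlt | heq
      · exact absurd (mem_ball.2 hlt) (disjoint_left.1 (P.gr.vertices_disjoint_ball q) hxv)
      · exact mem_sphere.2 heq
    exact hvert x hxv (P.dist_eq_of_mem_ringLevel_of_mem_sphere hΦ hcl hτI h01 hG hGc hn32 hskelT hR hqR hxq hxs)

include hΦ hcl hτI h01 hG hGc hn32 hskelT hR in
/-- **The leaf of the contour foliation through a point of the wiggly ring is compact** (generic
radius). [folklore] -/
theorem isCompact_leaf_of_mem_wigglyRing (ho : F.IsTransverselyOriented) (hvert : ∀ v ∈ P.gr.vertices, dist v c₀ ≠ R)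
    (hRL : R + 2 * P.gr.ℓ < L) (y₀ : P.gr.X₀) (hy₀ : (y₀ : ℝ × ℝ) ∈ P.wigglyRing R) :
    IsCompact ((P.contourFol ho).leaf y₀) := by
  have hWc := P.isCompact_wigglyRing hΦ hcl hτI h01 hG hGc hn32 hskelT hR
  set E := (P.contourFol ho).leaf y₀ with hE
  have hEsub : ((↑) : P.gr.X₀ → ℝ × ℝ) '' E ⊆ P.wigglyRing R := by
    rintro _ ⟨z, hz, rfl⟩
    exact P.leaf_subset_wigglyRing hΦ hcl hτI h01 hG hGc hn32 hskelT hR ho hy₀ z hz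
  -- the image of the leaf is closed in the plane
  have hclosed : IsClosed (((↑) : P.gr.X₀ → ℝ × ℝ) '' E) := by
    refine isClosed_of_closure_subset fun x hx ↦ ?_
    have hxW : x ∈ P.wigglyRing R := closure_minimal hEsub hWc.isClosed hx
    have hxX : x ∈ (P.gr.X₀ : Set (ℝ × ℝ)) := P.wigglyRing_subset_X₀ hΦ hcl hτI h01 hG hGc hn32 hskelT hR hvert hRL x hxW
    set v : P.gr.X₀ := ⟨x, hxX⟩ with hv
    obtain ⟨V, hVo, hvV, hV⟩ := P.exists_nhds_samePlaque hΦ hcl hτI h01 hG hGc hn32 hskelT hR ho v hxW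
    -- `coe '' V` is a neighbourhood of `x`: it meets the image of the leaf
    have hVimg : ((↑) : P.gr.X₀ → ℝ × ℝ) '' V ∈ 𝓝 x := by
      have hopen : IsOpen (((↑) : P.gr.X₀ → ℝ × ℝ) '' V) := P.gr.X₀.2.isOpenMap_subtype_val V hVo
      exact hopen.mem_nhds ⟨v, hvV, rfl⟩
    obtain ⟨_, ⟨w, hwV, rfl⟩, ⟨w', hw'E, hww'⟩⟩ := mem_closure_iff_nhds.1 hx _ hVimg
    have hw : w = w' := Subtype.ext hww'.symm
    subst hw
    have hsame := hV w hwV (hEsub ⟨w, hw'E, rfl⟩)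
    -- `w ∈ leaf v`, and `w ∈ leaf y₀`: so `v ∈ leaf y₀`
    have hwv : w ∈ (P.contourFol ho).leaf v := by
      rw [contourFol, leaf_biOrient]
      exact hsame.mem_leaf
    have hvE : v ∈ E := by
      rw [hE, ← leaf_eq_of_mem hw'E, mem_leaf_comm]
      exact hwv
    exact ⟨v, hvE, rfl⟩
  have himgc : IsCompact (((↑) : P.gr.X₀ → ℝ × ℝ) '' E) := hWc.of_isClosed_subset hclosed hEsub
  exact (Topology.IsEmbedding.subtypeVal.isCompact_iff).2 himgc

end Foliation.ConePosition

end Literature.Topology.FourManifolds
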